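import Summits.AtomisticToContinuum.HydrodynamicLimit.Theorems.InformationPercolationEngineChaosClosesEulerLocalEquilibriumFromDissipationA
import Literature.Analysis.FluidPDE.CollisionWeakForm
import Literature.MathematicalPhysics.KineticTheory.Hilbert6Wave0WeakFormProofs
import HarnessLib

/-!
# Pointwise local equilibrium from the empirical H-theorem (crux `ChaosClosesEuler`, stmt-AtomisticToContinuum-15141,
# line `empirical-h-theorem`, stub `stub_localEquilibriumFromDissipation`) — helper B: Boltzmann's inequality

WHAT. For a measurable log-density `Λ : V3 → ℝ` bounded by `C` on the pair-energy ball `{‖v‖² ≤ L}`, the cut Enskog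
prediction `predF L Λ` (the `Pred` of `PointwiseEntropicChaos`) and the cut dissipation `dissF L Λ` (the `D` of
`DissipationRigidity`) of helper A satisfy `dissF = 2 predF` (exchange symmetry `(v,u,ω) ↦ (u,v,−ω)`),
`predF ≥ 0`, `dissF ≥ 0` (collision symmetry `(v,u,ω) ↦ (u′,v′,ω)` and Boltzmann's inequality `(a−b)(eᵃ−eᵇ) ≥ 0`; the
cut set is collision invariant) and `|predF| ≤ predBound L C`. All symmetrised integrands are bounded, measurable and
supported in the cut set (finite `dv du dω`-measure), so every Fubini / change-of-variables step is honest
(`integral_comp_swap_negDir`, `integral_comp_collideSwap_prod` of `Literature.Analysis.FluidPDE.CollisionWeakForm`).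
References: C. Cercignani, R. Illner, M. Pulvirenti, *The Mathematical Theory of Dilute Gases* (1994) §3.1–3.2.
-/

noncomputable section

namespace Summit.AtomisticToContinuum.HydrodynamicLimit.Theorems.ChaosClosesEulerLocalEquilibriumFromDissipation

open scoped BigOperators Topology Classical MeasureTheory ENNReal InnerProductSpace
open Filter Set MeasureTheory Function
open Literature.MathematicalPhysics.KineticTheory
open Literature.Analysis.FluidPDE

/-- The unit sphere of velocity space (local notation). -/
local notation "S2" => Metric.sphere (0 : V3) 1

set_option quotPrecheck false in
/-- The measure `dv du dω` on `(V3 × V3) × S²` (local notation). -/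
local notation "μ3" => (MeasureTheory.Measure.prod (MeasureTheory.Measure.prod (volume : Measure V3) (volume : Measure V3))
  (sphereMeasure : Measure (Metric.sphere (0 : V3) 1)))

/-! ## §1 The hard-sphere kernel and the cut under the two involutions -/

/-- `((a − b)·ω)₊ ≤ ‖a‖ + ‖b‖`. [folklore] -/
theorem hsk_le (p : V3 × V3) (ω : S2) : hardSphereKernel p ω ≤ ‖p.1‖ + ‖p.2‖ := by
  unfold hardSphereKernel
  refine max_le ?_ (by positivity)
  calc ⟪p.1 - p.2, (ω : V3)⟫_ℝ ≤ ‖p.1 - p.2‖ * ‖(ω : V3)‖ := real_inner_le_norm _ _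
    _ = ‖p.1 - p.2‖ := by rw [norm_eq_of_mem_sphere ω, mul_one]
    _ ≤ ‖p.1‖ + ‖p.2‖ := norm_sub_le _ _

/-- Collision symmetry of the kernel: `B(collide ω p, ω) = B(p.swap, ω)`. [folklore] -/
theorem hsk_collide (p : V3 × V3) (ω : S2) : hardSphereKernel (collide ω p) ω = hardSphereKernel p.swap ω := by
  have h1 := hardSphereKernel_collide_neg p (-ω); rw [neg_neg, collide_neg_dir] at h1
  have h2 := hardSphereKernel_swap_neg p.swap ω; rw [Prod.swap_swap] at h2
  rw [h1, h2]

/-- From `‖v‖² ≤ L`: `‖v‖ ≤ max 1 L`. [folklore] -/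
theorem norm_le_of_sq_le {L : ℝ} {v : V3} (h : ‖v‖ ^ 2 ≤ L) : ‖v‖ ≤ max 1 L := by
  rcases le_or_gt ‖v‖ 1 with h1 | h1
  · exact h1.trans (le_max_left _ _)
  · exact (le_trans (by nlinarith) h).trans (le_max_right _ _)

/-- On the cut set all four velocities lie in the pair-energy ball. [folklore] -/
theorem sq_le_four {L : ℝ} {q : (V3 × V3) × S2} (hq : ‖q.1.1‖ ^ 2 + ‖q.1.2‖ ^ 2 ≤ L) :
    ‖q.1.1‖ ^ 2 ≤ L ∧ ‖q.1.2‖ ^ 2 ≤ L ∧ ‖(collide q.2 q.1).1‖ ^ 2 ≤ L ∧ ‖(collide q.2 q.1).2‖ ^ 2 ≤ L := by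
  have h := norm_sq_collide_fst_add_norm_sq_collide_snd q.2 q.1
  refine ⟨?_, ?_, ?_, ?_⟩ <;>
    nlinarith [sq_nonneg ‖q.1.1‖, sq_nonneg ‖q.1.2‖, sq_nonneg ‖(collide q.2 q.1).1‖, sq_nonneg ‖(collide q.2 q.1).2‖]

/-! ## §2 The common factor `cut(v, u) ((u − v)·ω)₊` and the four symmetrised integrands -/

/-- The common nonnegative factor `cut(v, u) · ((u − v)·ω)₊` of the cut functionals, on `(V3 × V3) × S²` with
`q = ((v, u), ω)`. [folklore] -/
def baseF (L : ℝ) (q : (V3 × V3) × S2) : ℝ := cutL L q.1.1 q.1.2 * hardSphereKernel (q.1.2, q.1.1) q.2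

/-- The integrand of `predF`: `base · (Λ(v) − Λ(v′)) · e^{Λ(v)} e^{Λ(u)}`. [folklore] -/
def I1 (L : ℝ) (Λ : V3 → ℝ) (q : (V3 × V3) × S2) : ℝ :=
  baseF L q * (Λ q.1.1 - Λ (collide q.2 q.1).1) * (Real.exp (Λ q.1.1) * Real.exp (Λ q.1.2))

/-- The exchanged integrand: `base · (Λ(u) − Λ(u′)) · e^{Λ(v)} e^{Λ(u)}`. [folklore] -/
def I2 (L : ℝ) (Λ : V3 → ℝ) (q : (V3 × V3) × S2) : ℝ :=
  baseF L q * (Λ q.1.2 - Λ (collide q.2 q.1).2) * (Real.exp (Λ q.1.1) * Real.exp (Λ q.1.2))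

/-- The integrand of `dissF`: `base · (Λ(v) + Λ(u) − Λ(v′) − Λ(u′)) · e^{Λ(v)} e^{Λ(u)}`. [folklore] -/
def ID (L : ℝ) (Λ : V3 → ℝ) (q : (V3 × V3) × S2) : ℝ :=
  baseF L q * (Λ q.1.1 + Λ q.1.2 - Λ (collide q.2 q.1).1 - Λ (collide q.2 q.1).2) *
    (Real.exp (Λ q.1.1) * Real.exp (Λ q.1.2))

/-- The post-collisional twin of `ID`: the same bracket times `e^{Λ(v′)} e^{Λ(u′)}`. [folklore] -/
def IDp (L : ℝ) (Λ : V3 → ℝ) (q : (V3 × V3) × S2) : ℝ :=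
  baseF L q * (Λ q.1.1 + Λ q.1.2 - Λ (collide q.2 q.1).1 - Λ (collide q.2 q.1).2) *
    (Real.exp (Λ (collide q.2 q.1).1) * Real.exp (Λ (collide q.2 q.1).2))

/-- The bound of the cut functionals: `8 max(1, L) C e^{2C}` times the `dv du dω`-measure of the cut set. [folklore] -/
def predBound (L C : ℝ) : ℝ :=
  8 * max 1 L * C * Real.exp C ^ 2 * (μ3).real {q : (V3 × V3) × S2 | ‖q.1.1‖ ^ 2 + ‖q.1.2‖ ^ 2 ≤ L}

variable {L C : ℝ} {Λ : V3 → ℝ}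

/-- `base ≥ 0`. [folklore] -/
theorem baseF_nonneg (L : ℝ) (q : (V3 × V3) × S2) : 0 ≤ baseF L q :=
  mul_nonneg (cutL_nonneg_le L _ _).1 (le_max_right _ _)

/-- `base` vanishes off the cut set. [folklore] -/
theorem baseF_eq_zero {L : ℝ} {q : (V3 × V3) × S2} (hq : ¬ ‖q.1.1‖ ^ 2 + ‖q.1.2‖ ^ 2 ≤ L) : baseF L q = 0 := by
  unfold baseF cutL; rw [if_neg hq, zero_mul]

/-- `base ≤ 2 max(1, L)`. [folklore] -/
theorem baseF_le (L : ℝ) (q : (V3 × V3) × S2) : baseF L q ≤ 2 * max 1 L := by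
  by_cases hq : ‖q.1.1‖ ^ 2 + ‖q.1.2‖ ^ 2 ≤ L
  · obtain ⟨hv, hu, -, -⟩ := sq_le_four (q := q) hq
    have hc := (cutL_nonneg_le L q.1.1 q.1.2).2
    have hk := hsk_le (q.1.2, q.1.1) q.2
    have h1 := norm_le_of_sq_le hv
    have h2 := norm_le_of_sq_le hu
    calc baseF L q ≤ 1 * (‖q.1.2‖ + ‖q.1.1‖) :=
          mul_le_mul hc hk (le_max_right _ _) zero_le_one
      _ ≤ 2 * max 1 L := by linarith
  · rw [baseF_eq_zero hq]; positivity

/-- Exchange symmetry of `base`: `base((u, v), −ω) = base((v, u), ω)`. [folklore] -/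
theorem baseF_T2 (L : ℝ) (q : (V3 × V3) × S2) : baseF L (q.1.swap, -q.2) = baseF L q := by
  unfold baseF
  simp only [Prod.fst_swap, Prod.snd_swap]
  rw [cutL_comm]
  exact congrArg _ (hardSphereKernel_swap_neg (q.1.2, q.1.1) q.2)

/-- Collision symmetry of `base`: `base((u′, v′), ω) = base((v, u), ω)`. [folklore] -/
theorem baseF_T1 (L : ℝ) (q : (V3 × V3) × S2) : baseF L ((collide q.2 q.1).swap, q.2) = baseF L q := by
  unfold baseF
  simp only [Prod.fst_swap, Prod.snd_swap]
  rw [cutL_comm, cutL_collide, Prod.mk.eta, hsk_collide]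
  rfl

/-- `I1 ∘ T₂ = I2`. [folklore] -/
theorem I1_T2 (L : ℝ) (Λ : V3 → ℝ) (q : (V3 × V3) × S2) : I1 L Λ (q.1.swap, -q.2) = I2 L Λ q := by
  unfold I1 I2
  rw [baseF_T2]
  simp only [Prod.fst_swap, Prod.snd_swap, collide_neg_dir, collide_swap]
  ring

/-- `ID ∘ T₁ = −IDp`. [folklore] -/
theorem ID_T1 (L : ℝ) (Λ : V3 → ℝ) (q : (V3 × V3) × S2) : ID L Λ ((collide q.2 q.1).swap, q.2) = -IDp L Λ q := by
  unfold ID IDp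
  rw [baseF_T1]
  simp only [Prod.fst_swap, Prod.snd_swap, collide_collideSwap]
  ring

/-- `ID = I1 + I2`. [folklore] -/
theorem ID_eq_add (L : ℝ) (Λ : V3 → ℝ) (q : (V3 × V3) × S2) : ID L Λ q = I1 L Λ q + I2 L Λ q := by unfold ID I1 I2; ring

/-- **Boltzmann's inequality, pointwise**: `ID − IDp = base · (a − b)(eᵃ − eᵇ) ≥ 0` with `a = Λ(v) + Λ(u)`,
`b = Λ(v′) + Λ(u′)`. [folklore] -/
theorem ID_sub_IDp_nonneg (L : ℝ) (Λ : V3 → ℝ) (q : (V3 × V3) × S2) : 0 ≤ ID L Λ q - IDp L Λ q := by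
  have hb := baseF_nonneg L q
  have key : ID L Λ q - IDp L Λ q = baseF L q * ((Λ q.1.1 + Λ q.1.2 - (Λ (collide q.2 q.1).1 + Λ (collide q.2 q.1).2)) *
      (Real.exp (Λ q.1.1 + Λ q.1.2) - Real.exp (Λ (collide q.2 q.1).1 + Λ (collide q.2 q.1).2))) := by
    unfold ID IDp; rw [Real.exp_add, Real.exp_add]; ring
  rw [key]
  refine mul_nonneg hb ?_
  rcases le_total (Λ q.1.1 + Λ q.1.2) (Λ (collide q.2 q.1).1 + Λ (collide q.2 q.1).2) with hab | hab
  · exact mul_nonneg_of_nonpos_of_nonpos (sub_nonpos.2 hab) (sub_nonpos.2 (Real.exp_le_exp.2 hab))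
  · exact mul_nonneg (sub_nonneg.2 hab) (sub_nonneg.2 (Real.exp_le_exp.2 hab))

/-! ## §3 Measurability, support and bounds -/

/-- The cut is jointly measurable. [folklore] -/
theorem measurable_cutL (L : ℝ) : Measurable fun p : V3 × V3 => cutL L p.1 p.2 := by
  unfold cutL
  refine Measurable.ite ?_ measurable_const measurable_const
  exact measurableSet_le ((measurable_fst.norm.pow_const 2).add (measurable_snd.norm.pow_const 2)) measurable_const

/-- The kernel `((u − v)·ω)₊` is jointly continuous in `((v, u), ω)`. [folklore] -/
theorem continuous_hsk : Continuous fun q : (V3 × V3) × S2 => hardSphereKernel (q.1.2, q.1.1) q.2 := by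
  unfold hardSphereKernel
  exact ((continuous_fst.snd.sub continuous_fst.fst).inner (continuous_subtype_val.comp continuous_snd)).max
    continuous_const

/-- `base` is measurable. [folklore] -/
theorem measurable_baseF (L : ℝ) : Measurable (baseF L) :=
  ((measurable_cutL L).comp measurable_fst).mul continuous_hsk.measurable

/-- The cut set is measurable. [folklore] -/
theorem measurableSet_cutSet (L : ℝ) : MeasurableSet {q : (V3 × V3) × S2 | ‖q.1.1‖ ^ 2 + ‖q.1.2‖ ^ 2 ≤ L} :=
  measurableSet_le ((measurable_fst.fst.norm.pow_const 2).add (measurable_fst.snd.norm.pow_const 2)) measurable_const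

/-- **The cut set has finite `dv du dω`-measure.** [folklore] -/
theorem measure_cutSet_lt_top (L : ℝ) : (μ3) {q : (V3 × V3) × S2 | ‖q.1.1‖ ^ 2 + ‖q.1.2‖ ^ 2 ≤ L} < ∞ := by
  have hsub : {q : (V3 × V3) × S2 | ‖q.1.1‖ ^ 2 + ‖q.1.2‖ ^ 2 ≤ L} ⊆
      (Metric.closedBall (0 : V3) (max 1 L) ×ˢ Metric.closedBall (0 : V3) (max 1 L)) ×ˢ (univ : Set S2) := by
    intro q hq
    simp only [mem_setOf_eq] at hq
    obtain ⟨hv, hu, -, -⟩ := sq_le_four (q := q) hq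
    refine ⟨⟨?_, ?_⟩, mem_univ _⟩
    · rw [mem_closedBall_zero_iff]; exact norm_le_of_sq_le hv
    · rw [mem_closedBall_zero_iff]; exact norm_le_of_sq_le hu
  refine lt_of_le_of_lt (measure_mono hsub) ?_
  haveI := isFiniteMeasure_sphereMeasure (E := V3)
  rw [Measure.prod_prod, Measure.prod_prod]
  exact ENNReal.mul_lt_top (ENNReal.mul_lt_top measure_closedBall_lt_top measure_closedBall_lt_top)
    (measure_lt_top _ _)

/-- **Integrability from support and bound**: a measurable function on `(V3 × V3) × S²`, bounded by `B` and vanishing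
off the cut set, is `dv du dω`-integrable. [folklore] -/
theorem integrable_of_cutSupport {F : (V3 × V3) × S2 → ℝ} (hF : Measurable F) {L B : ℝ} (hB : ∀ q, |F q| ≤ B)
    (h0 : ∀ q : (V3 × V3) × S2, ¬ ‖q.1.1‖ ^ 2 + ‖q.1.2‖ ^ 2 ≤ L → F q = 0) : Integrable F (μ3) := by
  set S := {q : (V3 × V3) × S2 | ‖q.1.1‖ ^ 2 + ‖q.1.2‖ ^ 2 ≤ L} with hS
  have hSm : MeasurableSet S := measurableSet_cutSet L
  have hg : Integrable (S.indicator fun _ => B) (μ3) :=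
    (integrableOn_const (C := B) (measure_cutSet_lt_top L).ne).integrable_indicator hSm
  refine hg.mono' hF.aestronglyMeasurable (ae_of_all _ fun q => ?_)
  by_cases hq : q ∈ S
  · rw [indicator_of_mem hq, Real.norm_eq_abs]; exact hB q
  · rw [indicator_of_notMem hq, Real.norm_eq_abs, h0 q hq, abs_zero]

/-- The bounding template: `|base · X · Y| ≤ 8 max(1,L) C e^{2C}` for `|X| ≤ 4C`, `0 ≤ Y ≤ e^{2C}`. [folklore] -/
theorem abs_base_mul_le (L : ℝ) (q : (V3 × V3) × S2) {C X Y : ℝ} (hC : 0 ≤ C) (hX : |X| ≤ 4 * C) (hY0 : 0 ≤ Y)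
    (hY : Y ≤ Real.exp C ^ 2) : |baseF L q * X * Y| ≤ 8 * max 1 L * C * Real.exp C ^ 2 := by
  have hb0 := baseF_nonneg L q
  have hb := baseF_le L q
  rw [abs_mul, abs_mul, abs_of_nonneg hb0, abs_of_nonneg hY0]
  calc baseF L q * |X| * Y ≤ (2 * max 1 L) * (4 * C) * Real.exp C ^ 2 :=
        mul_le_mul (mul_le_mul hb hX (abs_nonneg _) (by positivity)) hY hY0 (by positivity)
    _ = 8 * max 1 L * C * Real.exp C ^ 2 := by ring

section Bounds

variable (hC0 : 0 ≤ C) (hC : ∀ v : V3, ‖v‖ ^ 2 ≤ L → |Λ v| ≤ C)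
include hC0 hC

/-- `|I1|, |I2|, |ID|, |IDp| ≤ 8 max(1,L) C e^{2C}`. [folklore] -/
theorem abs_I_le (q : (V3 × V3) × S2) :
    |I1 L Λ q| ≤ 8 * max 1 L * C * Real.exp C ^ 2 ∧ |I2 L Λ q| ≤ 8 * max 1 L * C * Real.exp C ^ 2 ∧
    |ID L Λ q| ≤ 8 * max 1 L * C * Real.exp C ^ 2 ∧ |IDp L Λ q| ≤ 8 * max 1 L * C * Real.exp C ^ 2 := by
  by_cases hq : ‖q.1.1‖ ^ 2 + ‖q.1.2‖ ^ 2 ≤ L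
  · obtain ⟨hv, hu, hv', hu'⟩ := sq_le_four (q := q) hq
    have h1 := abs_le.1 (hC _ hv); have h2 := abs_le.1 (hC _ hu)
    have h3 := abs_le.1 (hC _ hv'); have h4 := abs_le.1 (hC _ hu')
    have e1 := Real.exp_le_exp.2 h1.2; have e2 := Real.exp_le_exp.2 h2.2
    have e3 := Real.exp_le_exp.2 h3.2; have e4 := Real.exp_le_exp.2 h4.2
    have p1 := (Real.exp_pos (Λ q.1.1)).le; have p3 := (Real.exp_pos (Λ (collide q.2 q.1).1)).le
    have hee : Real.exp (Λ q.1.1) * Real.exp (Λ q.1.2) ≤ Real.exp C ^ 2 := by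
      rw [sq]; exact mul_le_mul e1 e2 (Real.exp_pos _).le (Real.exp_pos _).le
    have hee' : Real.exp (Λ (collide q.2 q.1).1) * Real.exp (Λ (collide q.2 q.1).2) ≤ Real.exp C ^ 2 := by
      rw [sq]; exact mul_le_mul e3 e4 (Real.exp_pos _).le (Real.exp_pos _).le
    exact ⟨abs_base_mul_le L q hC0 (abs_le.2 ⟨by linarith, by linarith⟩) (by positivity) hee,
      abs_base_mul_le L q hC0 (abs_le.2 ⟨by linarith, by linarith⟩) (by positivity) hee,
      abs_base_mul_le L q hC0 (abs_le.2 ⟨by linarith, by linarith⟩) (by positivity) hee,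
      abs_base_mul_le L q hC0 (abs_le.2 ⟨by linarith, by linarith⟩) (by positivity) hee'⟩
  · have h0 : (0 : ℝ) ≤ 8 * max 1 L * C * Real.exp C ^ 2 := by positivity
    unfold I1 I2 ID IDp
    rw [baseF_eq_zero hq]
    simp only [zero_mul, abs_zero]
    exact ⟨h0, h0, h0, h0⟩

end Bounds

section Measurable

/-- The collision map is measurable on `(V3 × V3) × S²`. [folklore] -/
theorem measurable_collide_q : Measurable fun q : (V3 × V3) × S2 => collide q.2 q.1 :=
  (continuous_collide_uncurry (E := V3)).measurable

variable (hΛ : Measurable Λ)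
include hΛ

/-- `I1`, `I2`, `ID`, `IDp` are measurable. [folklore] -/
theorem measurable_I (L : ℝ) :
    Measurable (I1 L Λ) ∧ Measurable (I2 L Λ) ∧ Measurable (ID L Λ) ∧ Measurable (IDp L Λ) := by
  have hc := measurable_collide_q
  have h1 : Measurable fun q : (V3 × V3) × S2 => Λ q.1.1 := hΛ.comp measurable_fst.fst
  have h2 : Measurable fun q : (V3 × V3) × S2 => Λ q.1.2 := hΛ.comp measurable_fst.snd
  have h3 : Measurable fun q : (V3 × V3) × S2 => Λ (collide q.2 q.1).1 := hΛ.comp hc.fst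
  have h4 : Measurable fun q : (V3 × V3) × S2 => Λ (collide q.2 q.1).2 := hΛ.comp hc.snd
  have hb := measurable_baseF L
  unfold I1 I2 ID IDp
  exact ⟨(hb.mul (h1.sub h3)).mul (h1.exp.mul h2.exp), (hb.mul (h2.sub h4)).mul (h1.exp.mul h2.exp),
    (hb.mul (((h1.add h2).sub h3).sub h4)).mul (h1.exp.mul h2.exp),
    (hb.mul (((h1.add h2).sub h3).sub h4)).mul (h3.exp.mul h4.exp)⟩

end Measurable

/-! ## §4 The cut functionals as honest triple integrals -/

section Integrals

variable (hΛ : Measurable Λ) (hC0 : 0 ≤ C) (hC : ∀ v : V3, ‖v‖ ^ 2 ≤ L → |Λ v| ≤ C)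
include hΛ hC0 hC

/-- `I1` is integrable. [folklore] -/
theorem integrable_I1 : Integrable (I1 L Λ) (μ3) :=
  integrable_of_cutSupport (measurable_I hΛ L).1 (fun q => (abs_I_le hC0 hC q).1) fun q hq => by
    unfold I1; rw [baseF_eq_zero hq, zero_mul, zero_mul]

/-- `I2` is integrable. [folklore] -/
theorem integrable_I2 : Integrable (I2 L Λ) (μ3) :=
  integrable_of_cutSupport (measurable_I hΛ L).2.1 (fun q => (abs_I_le hC0 hC q).2.1) fun q hq => by
    unfold I2; rw [baseF_eq_zero hq, zero_mul, zero_mul]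

/-- `ID` is integrable. [folklore] -/
theorem integrable_ID : Integrable (ID L Λ) (μ3) :=
  integrable_of_cutSupport (measurable_I hΛ L).2.2.1 (fun q => (abs_I_le hC0 hC q).2.2.1) fun q hq => by
    unfold ID; rw [baseF_eq_zero hq, zero_mul, zero_mul]

/-- `IDp` is integrable. [folklore] -/
theorem integrable_IDp : Integrable (IDp L Λ) (μ3) :=
  integrable_of_cutSupport (measurable_I hΛ L).2.2.2 (fun q => (abs_I_le hC0 hC q).2.2.2) fun q hq => by
    unfold IDp; rw [baseF_eq_zero hq, zero_mul, zero_mul]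

/-- **`predF` is the triple integral of `I1`** (Fubini on `(V3 × V3) × S²`). [folklore] -/
theorem predF_eq_integral : predF L Λ = ∫ q, I1 L Λ q ∂(μ3) := by
  have hI := integrable_I1 hΛ hC0 hC
  rw [integral_prod _ hI, integral_prod _ hI.integral_prod_left]
  unfold predF
  refine integral_congr_ae (ae_of_all _ fun v => integral_congr_ae (ae_of_all _ fun u => ?_))
  show cutL L v u * (∫ ω : S2, (Λ v - Λ (collide ω (v, u)).1) * hardSphereKernel (u, v) ω ∂sphereMeasure) *
      (Real.exp (Λ v) * Real.exp (Λ u)) = ∫ ω : S2, I1 L Λ ((v, u), ω) ∂sphereMeasure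
  rw [← integral_const_mul, ← integral_mul_const]
  refine integral_congr_ae (ae_of_all _ fun ω => ?_)
  show cutL L v u * ((Λ v - Λ (collide ω (v, u)).1) * hardSphereKernel (u, v) ω) * (Real.exp (Λ v) * Real.exp (Λ u)) =
    cutL L v u * hardSphereKernel (u, v) ω * (Λ v - Λ (collide ω (v, u)).1) * (Real.exp (Λ v) * Real.exp (Λ u))
  ring

/-- **`dissF` is the triple integral of `ID`.** [folklore] -/
theorem dissF_eq_integral : dissF L Λ = ∫ q, ID L Λ q ∂(μ3) := by
  have hI := integrable_ID hΛ hC0 hC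
  rw [integral_prod _ hI, integral_prod _ hI.integral_prod_left]
  unfold dissF
  refine integral_congr_ae (ae_of_all _ fun v => integral_congr_ae (ae_of_all _ fun u => ?_))
  show cutL L v u * (∫ ω : S2, (Λ v + Λ u - Λ (collide ω (v, u)).1 - Λ (collide ω (v, u)).2) *
      hardSphereKernel (u, v) ω ∂sphereMeasure) * (Real.exp (Λ v) * Real.exp (Λ u)) =
    ∫ ω : S2, ID L Λ ((v, u), ω) ∂sphereMeasure
  rw [← integral_const_mul, ← integral_mul_const]
  refine integral_congr_ae (ae_of_all _ fun ω => ?_)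
  show cutL L v u * ((Λ v + Λ u - Λ (collide ω (v, u)).1 - Λ (collide ω (v, u)).2) * hardSphereKernel (u, v) ω) *
      (Real.exp (Λ v) * Real.exp (Λ u)) =
    cutL L v u * hardSphereKernel (u, v) ω * (Λ v + Λ u - Λ (collide ω (v, u)).1 - Λ (collide ω (v, u)).2) *
      (Real.exp (Λ v) * Real.exp (Λ u))
  ring

omit hΛ hC0 hC in
/-- **Exchange symmetry**: `∫ I1 = ∫ I2` (change of variables `(v, u, ω) ↦ (u, v, −ω)`). [folklore] -/
theorem integral_I1_eq_integral_I2 : ∫ q, I1 L Λ q ∂(μ3) = ∫ q, I2 L Λ q ∂(μ3) := by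
  rw [← integral_comp_swap_negDir (I1 L Λ)]
  exact integral_congr_ae (ae_of_all _ fun q => I1_T2 L Λ q)

omit hΛ hC0 hC in
/-- **Collision symmetry**: `∫ ID = −∫ IDp` (change of variables `(v, u, ω) ↦ (u′, v′, ω)`). [folklore] -/
theorem integral_ID_eq_neg : ∫ q, ID L Λ q ∂(μ3) = -∫ q, IDp L Λ q ∂(μ3) := by
  rw [← integral_comp_collideSwap_prod (ID L Λ), ← integral_neg]
  exact integral_congr_ae (ae_of_all _ fun q => ID_T1 L Λ q)

/-- **`D = 2𝒫`.** [folklore] -/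
theorem dissF_eq_two_mul_predF : dissF L Λ = 2 * predF L Λ := by
  rw [dissF_eq_integral hΛ hC0 hC, predF_eq_integral hΛ hC0 hC]
  have h := integral_add (integrable_I1 hΛ hC0 hC) (integrable_I2 hΛ hC0 hC)
  rw [← integral_I1_eq_integral_I2, ← two_mul] at h
  rw [← h]
  exact integral_congr_ae (ae_of_all _ fun q => ID_eq_add L Λ q)

/-- **`D ≥ 0`** (Boltzmann's inequality on the collision-invariant cut set). [folklore] -/
theorem dissF_nonneg : 0 ≤ dissF L Λ := by
  rw [dissF_eq_integral hΛ hC0 hC]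
  have h1 := integral_ID_eq_neg (L := L) (Λ := Λ)
  have h2 : 0 ≤ ∫ q, (ID L Λ q - IDp L Λ q) ∂(μ3) := integral_nonneg fun q => ID_sub_IDp_nonneg L Λ q
  rw [integral_sub (integrable_ID hΛ hC0 hC) (integrable_IDp hΛ hC0 hC)] at h2
  linarith

/-- **`𝒫 ≥ 0`.** [folklore] -/
theorem predF_nonneg : 0 ≤ predF L Λ := by
  linarith [dissF_eq_two_mul_predF hΛ hC0 hC, dissF_nonneg hΛ hC0 hC]

/-- **`|𝒫| ≤ predBound L C`.** [folklore] -/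
theorem abs_predF_le : |predF L Λ| ≤ predBound L C := by
  rw [predF_eq_integral hΛ hC0 hC]
  set S := {q : (V3 × V3) × S2 | ‖q.1.1‖ ^ 2 + ‖q.1.2‖ ^ 2 ≤ L} with hS
  have hSm : MeasurableSet S := measurableSet_cutSet L
  have hg : Integrable (S.indicator fun _ => 8 * max 1 L * C * Real.exp C ^ 2) (μ3) :=
    (integrableOn_const (C := 8 * max 1 L * C * Real.exp C ^ 2) (measure_cutSet_lt_top L).ne).integrable_indicator hSm
  calc |∫ q, I1 L Λ q ∂(μ3)| ≤ ∫ q, |I1 L Λ q| ∂(μ3) := abs_integral_le_integral_abs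
    _ ≤ ∫ q, S.indicator (fun _ => 8 * max 1 L * C * Real.exp C ^ 2) q ∂(μ3) := by
        refine integral_mono_of_nonneg (ae_of_all _ fun _ => abs_nonneg _) hg (ae_of_all _ fun q => ?_)
        show |I1 L Λ q| ≤ S.indicator (fun _ => 8 * max 1 L * C * Real.exp C ^ 2) q
        by_cases hq : q ∈ S
        · rw [indicator_of_mem hq]; exact (abs_I_le hC0 hC q).1
        · rw [indicator_of_notMem hq]
          unfold I1; rw [baseF_eq_zero hq, zero_mul, zero_mul, abs_zero]
    _ = predBound L C := by
        rw [integral_indicator_const _ hSm, smul_eq_mul, predBound]; ring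

end Integrals

/-! ## §5 Registered sub-goal -/

/-- **Registered sub-goal `stub_localEquilibriumFromDissipationB` (helper B of `stub_localEquilibriumFromDissipation`):
the cut Enskog prediction of a bounded measurable log-density is nonnegative** (Boltzmann's inequality on the
collision-invariant pair-energy set). [folklore] -/
theorem stub_localEquilibriumFromDissipationB : ∀ (L C : ℝ) (Λ : V3 → ℝ), Measurable Λ → 0 ≤ C → (∀ v : V3, ‖v‖ ^ 2 ≤ L → |Λ v| ≤ C) → 0 ≤ ∫ v : V3, ∫ u : V3, (if ‖v‖ ^ 2 + ‖u‖ ^ 2 ≤ L then (1 : ℝ) else 0) * (∫ ω : Metric.sphere (0 : V3) 1, (Λ v - Λ (collide ω (v, u)).1) * hardSphereKernel (u, v) ω ∂sphereMeasure) * (Real.exp (Λ v) * Real.exp (Λ u)) :=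
  fun _ _ _ hΛ hC0 hC => predF_nonneg hΛ hC0 hC

end Summit.AtomisticToContinuum.HydrodynamicLimit.Theorems.ChaosClosesEulerLocalEquilibriumFromDissipation

end
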